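import Summits.ValiantsHypothesis.ValiantsHypothesis.Theorems.LacunarySymmetroidMatrixDescartesCensusV19CSoundOrder

/-!
# `MatrixDescartes` census — soundness of the CASE-C checker: the coefficient dictionary (coefficient at a pair sum = sum of the atoms with that sum; `c⋆ = G_A + G_B`)

HONEST FRAMING.  Object-search cell `pub-symmetroid`; door-A item `DoorA26 = PosRootLawAt 2 6 19`
(stmt-ValiantsHypothesis-19979; OPEN, typed, never asserted).  Part of the proof that certificates accepted by `V19C.checkSupport` (`…CensusV19CCheck`)
exclude a nineteen on a one-collision support.  Concrete layer: the dictionary «coefficient at a pair sum = sum of the values of the atoms with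
that pair sum» for ANY six-term real symmetric `2 × 2` pencil (`coeff_pdet_eq_sum_atoms`, from the tree's `coeff_det_pencil_two`), hence on a
checked one-collision support the coefficient at an uncollided sum is its atom and at the collided sum it is the composite `G_A + G_B`; and the
support of the determinant lies in the `20` sums.  Nothing here bears on the `2`-Sidon supports, on `ζ_sym(2,6)` over all supports, on `DoorA26`
itself, on `MatrixDescartes` (stmt-ValiantsHypothesis-18050) or on `VP ≠ VNP`.

[folklore] Certificate-checker soundness; elementary.
-/

-- the D-0017 layout repeats a namespace component (single-conjunct summit); the `dupNamespace` linter flags it; name mandated.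
set_option linter.dupNamespace false

namespace Summit.ValiantsHypothesis.ValiantsHypothesis.Theorems.LacunarySymmetroidMatrixDescartes.Census.V19C

open V20 (Atom allAtoms psum posOf qA cA Term PolySpec posl FNat fval Row FRat negAt tval pval lprod aval qv bv pdet dfun fin6
  posOf_lt_length getD_posOf mem_allAtoms_iff qA_mem cA_mem psum_cA fin6_eq aval_qA aval_cA)

section Dict

open Polynomial Finset
open scoped BigOperators Polynomial Matrix

variable {dl : List ℕ} {ord : List Atom} {pstar : ℕ}

/-! ### The dictionary: the coefficient at a pair sum is the sum of the atoms with that pair sum -/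

variable {S : Fin 6 → Matrix (Fin 2) (Fin 2) ℝ}

/-- For ANY six-term support: the coefficient of the pencil determinant at `e` is the sum of the values of the atoms with pair sum
`e` (ordered pairs `(i,j)`, `(j,i)` grouped into the atom `β i j`; diagonal pairs are the atoms `q i`). [folklore] -/
theorem coeff_pdet_eq_sum_atoms (hS : ∀ l, (S l).IsSymm) (e : ℕ) :
    (pdet dl S).coeff e = ∑ a ∈ allAtoms.toFinset.filter (fun a => psum dl a = e), aval S a := by
  classical
  have hsym : ∀ l, S l 1 0 = S l 0 1 := fun l => by
    have h := congrFun (congrFun (hS l) 1) 0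
    simp only [Matrix.transpose_apply] at h
    exact h.symm
  unfold pdet
  rw [coeff_det_pencil_two]
  have hget : ∀ i : Fin 6, dfun dl i = dl.getD i.val 0 := fun i => rfl
  -- group the ordered pairs by their atom
  set s := (Finset.univ : Finset (Fin 6 × Fin 6)).filter (fun p => dfun dl p.1 + dfun dl p.2 = e) with hs
  set T := allAtoms.toFinset.filter (fun a => psum dl a = e) with hT
  have hmaps : ∀ p ∈ s, cA p.1.val p.2.val ∈ T := by
    intro p hp
    rw [hs, Finset.mem_filter] at hp
    rw [hT, Finset.mem_filter, List.mem_toFinset]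
    exact ⟨cA_mem p.1.isLt p.2.isLt, by rw [psum_cA, ← hget, ← hget]; exact hp.2⟩
  rw [← Finset.sum_fiberwise_of_maps_to hmaps]
  refine Finset.sum_congr rfl fun a ha => ?_
  rw [hT, Finset.mem_filter, List.mem_toFinset] at ha
  obtain ⟨ha, hae⟩ := ha
  obtain ⟨i, j⟩ := a
  obtain ⟨hij, hj⟩ : i ≤ j ∧ j < 6 := (mem_allAtoms_iff _).1 ha
  have hi : i < 6 := by omega
  have hae' : dl.getD i 0 + dl.getD j 0 = e := hae
  rcases hij.eq_or_lt with rfl | hlt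
  · -- diagonal atom: the fiber is `{(i,i)}`
    have hfib : s.filter (fun p => cA p.1.val p.2.val = (i, i)) = {(⟨i, hi⟩, ⟨i, hi⟩)} := by
      ext p
      simp only [Finset.mem_filter, Finset.mem_singleton, hs, Finset.mem_univ, true_and]
      constructor
      · rintro ⟨-, hc⟩
        unfold cA at hc
        split_ifs at hc with hle <;> simp only [Prod.mk.injEq] at hc <;>
          exact Prod.ext (Fin.ext (by simp; omega)) (Fin.ext (by simp; omega))
      · rintro rfl
        refine ⟨?_, by simp [cA]⟩
        exact hae'
    rw [hfib, Finset.sum_singleton]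
    simp only [aval, if_true, qv, fin6_eq hi, hsym]
    ring
  · -- off-diagonal atom: the fiber is `{(i,j), (j,i)}`
    have hne : (⟨i, hi⟩ : Fin 6) ≠ ⟨j, hj⟩ := by intro h; simp at h; omega
    have hne2 : ((⟨i, hi⟩, ⟨j, hj⟩) : Fin 6 × Fin 6) ≠ (⟨j, hj⟩, ⟨i, hi⟩) := by
      intro h; exact hne (Prod.mk.inj h).1
    have hfib : s.filter (fun p => cA p.1.val p.2.val = (i, j)) = {(⟨i, hi⟩, ⟨j, hj⟩), (⟨j, hj⟩, ⟨i, hi⟩)} := by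
      ext p
      simp only [Finset.mem_filter, Finset.mem_insert, Finset.mem_singleton, hs, Finset.mem_univ, true_and]
      constructor
      · rintro ⟨-, hc⟩
        unfold cA at hc
        split_ifs at hc with hle <;> simp only [Prod.mk.injEq] at hc
        · exact Or.inl (Prod.ext (Fin.ext (by simp; omega)) (Fin.ext (by simp; omega)))
        · exact Or.inr (Prod.ext (Fin.ext (by simp; omega)) (Fin.ext (by simp; omega)))
      · rintro (rfl | rfl)
        · refine ⟨?_, by simp [cA, hlt.le]⟩
          exact hae'
        · refine ⟨?_, by simp [cA]; omega⟩
          show dl.getD j 0 + dl.getD i 0 = e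
          rw [add_comm]; exact hae'
    rw [hfib, Finset.sum_pair hne2]
    simp only [aval, if_neg hlt.ne, bv, fin6_eq hi, fin6_eq hj, hsym]
    ring

/-- The pair sums of the support are the `20` sums. [folklore] -/
theorem psum_mem_E (h : ordOK dl ord pstar = true) {a : Atom} (ha : a ∈ allAtoms) :
    psum dl a ∈ ((ord.eraseIdx (pstar + 1)).map (psum dl)).toFinset := by
  rw [List.mem_toFinset]
  rcases mem_o20_or_eq_B h ha with hm | hB
  · exact List.mem_map.2 ⟨a, hm, rfl⟩
  · rw [hB, psum_B h, List.getD_eq_getElem _ _ (by rw [length_E h]; have := (ordOK_spec h).2.2.2.2.1; omega)]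
    exact List.getElem_mem _

/-- The support of the pencil determinant lies in the `20` sums. [folklore] -/
theorem support_subset_E (h : ordOK dl ord pstar = true) (S : Fin 6 → Matrix (Fin 2) (Fin 2) ℝ) :
    (pdet dl S).support ⊆ ((ord.eraseIdx (pstar + 1)).map (psum dl)).toFinset := by
  intro e he
  have he' := support_det_pencil_subset_sumset (dfun dl) S he
  rw [Finset.mem_image] at he'
  obtain ⟨g, -, rfl⟩ := he'
  have : (∑ i, dfun dl (g i)) = psum dl (cA (g 0).val (g 1).val) := by
    rw [Fin.sum_univ_two, psum_cA]; rfl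
  rw [this]
  exact psum_mem_E h (cA_mem (g 0).isLt (g 1).isLt)

/-- **Dictionary at an uncollided position** `t ≠ p⋆`: the coefficient at the `t`-th sum is the value of the `t`-th atom. [folklore] -/
theorem coeff_E_of_ne (h : ordOK dl ord pstar = true) (hS : ∀ l, (S l).IsSymm) {t : ℕ} (ht : t < 20) (htp : t ≠ pstar) :
    (pdet dl S).coeff (((ord.eraseIdx (pstar + 1)).map (psum dl)).getD t 0)
      = aval S ((ord.eraseIdx (pstar + 1))[t]'(by rw [length_o20 h]; exact ht)) := by
  classical
  rw [coeff_pdet_eq_sum_atoms hS]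
  have hset : allAtoms.toFinset.filter (fun a => psum dl a = ((ord.eraseIdx (pstar + 1)).map (psum dl)).getD t 0)
      = {(ord.eraseIdx (pstar + 1))[t]'(by rw [length_o20 h]; exact ht)} := by
    ext a
    rw [Finset.mem_filter, List.mem_toFinset, Finset.mem_singleton]
    constructor
    · rintro ⟨ha, he⟩
      rcases atom_of_psum_eq h ha ht he with e | ⟨-, e⟩
      · exact e
      · exact absurd e htp
    · rintro rfl
      exact ⟨o20_mem_allAtoms h ht, (E_getD h ht).symm⟩
  rw [hset, Finset.sum_singleton]

/-- **Dictionary at the collided position** `p⋆`: the coefficient is the COMPOSITE `G_A + G_B`. [folklore] -/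
theorem coeff_E_pstar (h : ordOK dl ord pstar = true) (hS : ∀ l, (S l).IsSymm) :
    (pdet dl S).coeff (((ord.eraseIdx (pstar + 1)).map (psum dl)).getD pstar 0)
      = aval S (ord.getD pstar (0, 0)) + aval S (ord.getD (pstar + 1) (0, 0)) := by
  classical
  have hp := (ordOK_spec h).2.2.2.2.1
  rw [coeff_pdet_eq_sum_atoms hS]
  have hset : allAtoms.toFinset.filter (fun a => psum dl a = ((ord.eraseIdx (pstar + 1)).map (psum dl)).getD pstar 0)
      = {ord.getD pstar (0, 0), ord.getD (pstar + 1) (0, 0)} := by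
    ext a
    rw [Finset.mem_filter, List.mem_toFinset, Finset.mem_insert, Finset.mem_singleton]
    constructor
    · rintro ⟨ha, he⟩
      rcases atom_of_psum_eq h ha (by omega) he with e | ⟨e, -⟩
      · left; rw [e, o20_getElem_pstar h]
      · right; exact e
    · rintro (rfl | rfl)
      · exact ⟨A_mem h, psum_A h⟩
      · exact ⟨B_mem h, psum_B h⟩
  rw [hset, Finset.sum_pair (A_ne_B h)]

end Dict

end Summit.ValiantsHypothesis.ValiantsHypothesis.Theorems.LacunarySymmetroidMatrixDescartes.Census.V19C
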